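import Summits.RiemannHypothesis.RiemannHypothesis.Theorems.WeilFormatCPolyWindowPrimeBox
import Summits.RiemannHypothesis.RiemannHypothesis.Theorems.WeilFormatCPolyWindowEntry
import Summits.RiemannHypothesis.RiemannHypothesis.Theorems.WeilFormatCPolyWindowArchExpansion
import Summits.RiemannHypothesis.RiemannHypothesis.Theorems.WeilFormatCEntry
import HarnessLib

/-!
# Format C, design C∞ — (E) side II-c/d: the archimedean term, the Markov constant, and the monomial-window ENTRY box

Route context: Fourier–Galerkin / Schur-complement certificates of Weil positivity on a window ("format C", design C∞;
`run/shared/lean/pub/rh-explicit/rh-explicit-weil-10/KERNEL-LEVER.md` §17; supporting stmt-RiemannHypothesis-0098; seats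
rh-explicit-weil-2 / weil-10).  Completes the kernel evaluation of the profile × profile entries
`W_a(1x^j, 1x^k) = POLE_{jk} + PRIME_{jk} + ARCH_{jk} − M_a m_{j+k}` (`WeilFormatCPolyWindowEntry.weilWindowSesq_indicator_pow`)
for a RATIONAL window `a`:

* `sumBox` — generic `Σ_{i<n}` of boxes (`mem_sumBox`);
* `archOverlapBox tab a j k ∋ ∫_{(0,2a]} ρ (O_{jk} − m_{j+k})` from a certified TABLE of window constants `tab` (entry `q−1` ∋ `W_q(a)`,
  `q ≤ j+k+1`; `WeilFormatCPolyWindowConstantsTable.lean`), by `setIntegral_weilArchDensity_mul_overlapPoly_sub_moment`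
  (`mem_archOverlapBox`); `archInBox ∋ ∫_{(0,2a]} ρ K_{jk} = −X_{jk} − X_{kj}` (`setIntegral_weilArchDensity_mul_incrementPoly`);
* `tailBox ∋ ∫_{(2a,∞)} ρ = Σ_k e^{−2a l_k}/l_k` (near nodes + geometric far interval; `hasSum_setIntegral_Ioi_weilArchDensity`);
* `markovBox ∋ M_a = 2Σ_{log n<2a} Λ(n)n^{−1/2} + π/2 + log 2 + log 4π + γ` (`WeilFormatCEntry.weilMarkovConstant_eq`) from the
  prime weights of `ConstsValid` and input boxes for `π`, `log 2`, `log π`, `γ`;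
* **`entryBox`** and **`mem_entryBox`**: the real number `E_{jk}` with `weilWindowSesq a (1x^j) (1x^k) = E_{jk}`
  (`weilWindowSesq_indicator_pow_eq_entryVal`) lies in `entryBox`.

Interval plumbing over the landed analysis; standard axioms; no RH claim.
-/

set_option autoImplicit false
-- `Summit.RiemannHypothesis.RiemannHypothesis.…` is the layout-mandated namespace (summit = problem name).
set_option linter.dupNamespace false

open Complex Filter Set MeasureTheory Finset
open scoped Real Topology ArithmeticFunction.vonMangoldt

namespace Summit.RiemannHypothesis.RiemannHypothesis.Theorems.WeilFormatC

open Literature.NumberTheory.LFunctions Literature.Analysis.SpecialFunctions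
open Literature.Analysis.ValidatedNumerics Literature.Analysis.ValidatedNumerics.NumericsMP
open Literature.NumberTheory.LFunctions.Yoshida1992 (PrimeLen PrimeData)
open Literature.NumberTheory.LFunctions.Yoshida1992.Encl (Consts ConstsValid list_sum_map_eq_sum_range)

namespace WinEntry

open WinConst (ratBox mem_ratBox mulRatBox mem_mulRatBox nodeExp mem_nodeExp)
open WinPole (momentQ momentQ_cast poleBox mem_poleBox)
open WinPrime (primeBox mem_primeBox sum_weilPrimeIndex_mul_eq_listSum)

/-! ## Generic finite sums of boxes -/

/-- `Σ_{i<n} f i` of boxes. -/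
def sumBox (S : ℕ) (f : ℕ → MI) : ℕ → MI
  | 0 => MI.ofInt S 0
  | n + 1 => (sumBox S f n).add (f n)

/-- `sumBox ∋ Σ_{i<n} g i` whenever `f i ∋ g i` for `i < n`. -/
theorem mem_sumBox {S : ℕ} {f : ℕ → MI} {g : ℕ → ℝ} :
    ∀ n : ℕ, (∀ i < n, MI.mem S (g i) (f i)) → MI.mem S (∑ i ∈ Finset.range n, g i) (sumBox S f n)
  | 0, _ => by simpa [sumBox] using MI.mem_ofInt S 0
  | n + 1, h => by
    rw [Finset.sum_range_succ, sumBox]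
    exact MI.mem_add (mem_sumBox n fun i hi ↦ h i (by omega)) (h n (by omega))

/-! ## The archimedean window integrals through the table of window constants -/

section Arch

variable {S : ℕ} {a : ℚ} {tab : List MI} {Q : ℕ}

/-- Entry `q − 1` of the table: the box of `W_q(a)`. -/
def wtab (tab : List MI) (q : ℕ) : MI := tab.getD (q - 1) default

/-- Box of `X_{jk} = ∫_{(0,2a]} ρ (O_{jk} − m_{j+k})` along `setIntegral_weilArchDensity_mul_overlapPoly_sub_moment`. -/
def archOverlapBox (S : ℕ) (tab : List MI) (a : ℚ) (j k : ℕ) : MI :=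
  (sumBox S (fun i ↦ mulRatBox
      ((sumBox S (fun l ↦ mulRatBox (wtab tab (j - 1 - i + l + 1))
          ((((i + k + 1).choose l : ℕ) : ℚ) * (-1) ^ l * a ^ (i + k + 1 - l))) (i + k + 2)).sub
        (mulRatBox (wtab tab (j - 1 - i + 1)) ((-a) ^ (i + k + 1))))
      (((j.choose i : ℕ) : ℚ) / (i + k + 1))) j).add
    (mulRatBox (sumBox S (fun l ↦ mulRatBox (wtab tab (l + 1))
        ((((j + k + 1).choose (l + 1) : ℕ) : ℚ) * (-1) ^ (l + 1) * a ^ (j + k + 1 - (l + 1)))) (j + k + 1))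
      (1 / ((j : ℚ) + k + 1)))

/-- **`archOverlapBox ∋ X_{jk}`** given a valid table of window constants up to `Q ≥ j + k + 1` (`a > 0`). -/
theorem mem_archOverlapBox (ha : 0 < a) (hW : ∀ q, 1 ≤ q → q ≤ Q →
      MI.mem S (∫ t in Ioc 0 (2 * (a : ℝ)), weilArchDensity t * t ^ q) (wtab tab q))
    {j k : ℕ} (hjk : j + k + 1 ≤ Q) :
    MI.mem S (∫ t in Ioc 0 (2 * (a : ℝ)), weilArchDensity t *
        ((∑ i ∈ Finset.range (j + 1), (j.choose i : ℝ) * t ^ (j - i) *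
            ((((a : ℝ) - t) ^ (i + k + 1) - (-(a : ℝ)) ^ (i + k + 1)) / (i + k + 1))) -
          ((a : ℝ) ^ (j + k + 1) - (-(a : ℝ)) ^ (j + k + 1)) / (j + k + 1)))
      (archOverlapBox S tab a j k) := by
  have ha' : (0 : ℝ) < a := by exact_mod_cast ha
  rw [setIntegral_weilArchDensity_mul_overlapPoly_sub_moment ha' j k, archOverlapBox]
  refine MI.mem_add ?_ ?_
  · refine mem_sumBox j fun i hi ↦ ?_
    have hinner : MI.mem S
        ((∑ l ∈ Finset.range (i + k + 2), (((i + k + 1).choose l : ℝ) * (-1) ^ l * (a : ℝ) ^ (i + k + 1 - l) *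
            ∫ t in Ioc 0 (2 * (a : ℝ)), weilArchDensity t * t ^ (j - 1 - i + l + 1))) -
          (-(a : ℝ)) ^ (i + k + 1) * ∫ t in Ioc 0 (2 * (a : ℝ)), weilArchDensity t * t ^ (j - 1 - i + 1))
        ((sumBox S (fun l ↦ mulRatBox (wtab tab (j - 1 - i + l + 1))
            ((((i + k + 1).choose l : ℕ) : ℚ) * (-1) ^ l * a ^ (i + k + 1 - l))) (i + k + 2)).sub
          (mulRatBox (wtab tab (j - 1 - i + 1)) ((-a) ^ (i + k + 1)))) := by
      refine MI.mem_sub (mem_sumBox (i + k + 2) fun l hl ↦ ?_) ?_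
      · have h := mem_mulRatBox (hW (j - 1 - i + l + 1) (by omega) (by omega))
          ((((i + k + 1).choose l : ℕ) : ℚ) * (-1) ^ l * a ^ (i + k + 1 - l))
        convert h using 1
        push_cast
        ring
      · have h := mem_mulRatBox (hW (j - 1 - i + 1) (by omega) (by omega)) ((-a) ^ (i + k + 1))
        convert h using 1
        push_cast
        ring
    have h := mem_mulRatBox hinner (((j.choose i : ℕ) : ℚ) / (i + k + 1))
    convert h using 1
    push_cast
    ring
  · have hinner : MI.mem S
        (∑ l ∈ Finset.range (j + k + 1), ((j + k + 1).choose (l + 1) : ℝ) * (-1) ^ (l + 1) *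
          (a : ℝ) ^ (j + k + 1 - (l + 1)) * ∫ t in Ioc 0 (2 * (a : ℝ)), weilArchDensity t * t ^ (l + 1))
        (sumBox S (fun l ↦ mulRatBox (wtab tab (l + 1))
          ((((j + k + 1).choose (l + 1) : ℕ) : ℚ) * (-1) ^ (l + 1) * a ^ (j + k + 1 - (l + 1)))) (j + k + 1)) := by
      refine mem_sumBox (j + k + 1) fun l hl ↦ ?_
      have h := mem_mulRatBox (hW (l + 1) (by omega) (by omega))
        ((((j + k + 1).choose (l + 1) : ℕ) : ℚ) * (-1) ^ (l + 1) * a ^ (j + k + 1 - (l + 1)))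
      convert h using 1
      push_cast
      ring
    have h := mem_mulRatBox hinner (1 / ((j : ℚ) + k + 1))
    convert h using 1
    push_cast
    ring

/-- Box of `∫_{(0,2a]} ρ K_{jk} = −X_{jk} − X_{kj}`. -/
def archInBox (S : ℕ) (tab : List MI) (a : ℚ) (j k : ℕ) : MI :=
  ((archOverlapBox S tab a j k).neg).sub (archOverlapBox S tab a k j)

/-- **`archInBox ∋ ∫_{(0,2a]} ρ K_{jk}`** (the inner archimedean integral of `weilWindowSesq_indicator_pow`). -/
theorem mem_archInBox (ha : 0 < a) (hW : ∀ q, 1 ≤ q → q ≤ Q →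
      MI.mem S (∫ t in Ioc 0 (2 * (a : ℝ)), weilArchDensity t * t ^ q) (wtab tab q))
    {j k : ℕ} (hjk : j + k + 1 ≤ Q) :
    MI.mem S (∫ t in Ioc 0 (2 * (a : ℝ)), weilArchDensity t *
        (2 * (((a : ℝ) ^ (j + k + 1) - (-(a : ℝ)) ^ (j + k + 1)) / (j + k + 1))
          - (∑ i ∈ Finset.range (j + 1), (j.choose i : ℝ) * t ^ (j - i) *
              ((((a : ℝ) - t) ^ (i + k + 1) - (-(a : ℝ)) ^ (i + k + 1)) / (i + k + 1)))
          - (∑ i ∈ Finset.range (k + 1), (k.choose i : ℝ) * t ^ (k - i) *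
              ((((a : ℝ) - t) ^ (i + j + 1) - (-(a : ℝ)) ^ (i + j + 1)) / (i + j + 1)))))
      (archInBox S tab a j k) := by
  have ha' : (0 : ℝ) < a := by exact_mod_cast ha
  rw [setIntegral_weilArchDensity_mul_incrementPoly ha' j k, archInBox]
  exact MI.mem_sub (MI.mem_neg (mem_archOverlapBox ha hW hjk))
    (mem_archOverlapBox ha hW (by omega : k + j + 1 ≤ Q))

end Arch

/-! ## The tail `∫_{(2a,∞)} ρ` -/

section Tail

variable {S Kser kred : ℕ} {a : ℚ}

/-- The scaled upper end of `e^{−2a l_K}/(l_K(1 − e^{−4a}))`, majorant of the far tail nodes. -/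
def tailFarHi (S Kser kred : ℕ) (a : ℚ) (K : ℕ) : Option ℤ :=
  match nodeExp S Kser kred a K, MI.exp S Kser kred (ratBox S (-(4 * a))) with
  | some E, some E4 =>
    match MI.divPos S (mulRatBox E (2 / (4 * (K : ℚ) + 1))) ((MI.ofInt S 1).sub E4) with
    | some R => some R.hi
    | none => none
  | _, _ => none

/-- Near part `Σ_{k<K} e^{−2a l_k}/l_k`. -/
def tailNear (S Kser kred : ℕ) (a : ℚ) : ℕ → Option MI
  | 0 => some (MI.ofInt S 0)
  | K + 1 =>
    match tailNear S Kser kred a K, nodeExp S Kser kred a K with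
    | some acc, some E => some (acc.add (mulRatBox E (2 / (4 * (K : ℚ) + 1))))
    | _, _ => none

/-- **The tail box**: `Σ_{k<K} e^{−2a l_k}/l_k + [0, e^{−2a l_K}/(l_K(1−e^{−4a}))]`. -/
def tailBox (S Kser kred : ℕ) (a : ℚ) (K : ℕ) : Option MI :=
  match tailNear S Kser kred a K, tailFarHi S Kser kred a K with
  | some N, some u => some (N.add ⟨0, u⟩)
  | _, _ => none

/-- `1/l_k = 2/(4k+1)`. -/
private theorem inv_digammaNode (k : ℕ) : (digammaNode k)⁻¹ = ((2 / (4 * (k : ℚ) + 1) : ℚ) : ℝ) := by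
  rw [digammaNode]; push_cast
  have : (4 * (k : ℝ) + 1) ≠ 0 := by positivity
  field_simp
  ring

/-- `tailNear ∋ Σ_{k<K} e^{−2a l_k}/l_k`. -/
theorem mem_tailNear (hS : 0 < S) :
    ∀ (K : ℕ) {N : MI}, tailNear S Kser kred a K = some N →
      MI.mem S (∑ k ∈ Finset.range K, Real.exp (-(digammaNode k * (2 * (a : ℝ)))) / digammaNode k) N
  | 0, N, h => by
    simp only [tailNear, Option.some.injEq] at h
    subst h; simpa using MI.mem_ofInt S 0
  | K + 1, N, h => by
    simp only [tailNear] at h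
    split at h
    · rename_i acc E hacc hE
      simp only [Option.some.injEq] at h
      subst h
      rw [Finset.sum_range_succ]
      refine MI.mem_add (mem_tailNear hS K hacc) ?_
      have h := mem_mulRatBox (mem_nodeExp hS hE) (2 / (4 * (K : ℚ) + 1))
      convert h using 1
      rw [div_eq_mul_inv, inv_digammaNode, show digammaNode K * (2 * (a : ℝ)) = 2 * (a : ℝ) * digammaNode K by ring]
    · simp at h

/-- **`tailBox ∋ ∫_{(2a,∞)} ρ`** (`a > 0`). -/
theorem mem_tailBox (hS : 0 < S) (ha : 0 < a) {K : ℕ} {T : MI} (hT : tailBox S Kser kred a K = some T) :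
    MI.mem S (∫ t in Ioi (2 * (a : ℝ)), weilArchDensity t) T := by
  have ha' : (0 : ℝ) < a := by exact_mod_cast ha
  have hSr : (0 : ℝ) < S := by exact_mod_cast hS
  have hsum := hasSum_setIntegral_Ioi_weilArchDensity ha'
  have hsplit := (hsum.summable.sum_add_tsum_nat_add K).symm
  rw [hsum.tsum_eq] at hsplit
  have hfar : HasSum (fun j : ℕ ↦ Real.exp (-(digammaNode (j + K) * (2 * (a : ℝ)))) / digammaNode (j + K))
      (∑' j : ℕ, Real.exp (-(digammaNode (j + K) * (2 * (a : ℝ)))) / digammaNode (j + K)) :=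
    ((summable_nat_add_iff K).2 hsum.summable).hasSum
  -- geometric majorant of the far part
  set r : ℝ := Real.exp (-(4 * (a : ℝ))) with hr
  have hr0 : 0 ≤ r := (Real.exp_pos _).le
  have hr1 : r < 1 := by rw [hr]; exact Real.exp_lt_one_iff.2 (by linarith)
  set eK : ℝ := Real.exp (-(2 * (a : ℝ) * digammaNode K)) with heK
  have hlK := digammaNode_pos K
  have hgeom : HasSum (fun j : ℕ ↦ eK / digammaNode K * r ^ j) (eK / digammaNode K * (1 - r)⁻¹) :=
    (hasSum_geometric_of_lt_one hr0 hr1).mul_left _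
  have hF0 : 0 ≤ ∑' j : ℕ, Real.exp (-(digammaNode (j + K) * (2 * (a : ℝ)))) / digammaNode (j + K) :=
    hfar.nonneg fun j ↦ div_nonneg (Real.exp_pos _).le (digammaNode_pos _).le
  have hle : ∑' j : ℕ, Real.exp (-(digammaNode (j + K) * (2 * (a : ℝ)))) / digammaNode (j + K) ≤
      eK / digammaNode K * (1 - r)⁻¹ := by
    refine hasSum_le (fun j ↦ ?_) hfar hgeom
    have e1 : Real.exp (-(digammaNode (j + K) * (2 * (a : ℝ)))) = eK * r ^ j := by
      rw [heK, hr, ← Real.exp_nat_mul, ← Real.exp_add]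
      congr 1; unfold digammaNode; push_cast; ring
    rw [e1]
    have hmono : digammaNode K ≤ digammaNode (j + K) := by
      unfold digammaNode; push_cast; linarith [Nat.cast_nonneg (α := ℝ) j]
    have : eK * r ^ j / digammaNode (j + K) ≤ eK * r ^ j / digammaNode K :=
      div_le_div_of_nonneg_left (by positivity) hlK hmono
    calc eK * r ^ j / digammaNode (j + K) ≤ eK * r ^ j / digammaNode K := this
      _ = eK / digammaNode K * r ^ j := by ring
  unfold tailBox at hT
  split at hT
  · rename_i N u hN hu
    simp only [Option.some.injEq] at hT
    subst hT
    rw [hsplit]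
    refine MI.mem_add (mem_tailNear hS K hN) ⟨?_, ?_⟩
    · push_cast; positivity
    · unfold tailFarHi at hu
      split at hu
      · rename_i E E4 hE hE4
        split at hu
        · rename_i R hR
          simp only [Option.some.injEq] at hu
          subst hu
          have hE4m : MI.mem S r E4 := by
            have := MI.mem_exp hS hE4 (mem_ratBox S (-(4 * a)))
            rw [hr]; convert this using 2; push_cast; ring
          have hden : MI.mem S (1 - r) ((MI.ofInt S 1).sub E4) := by
            have := MI.mem_sub (MI.mem_ofInt S 1) hE4m
            simpa using this
          have hnum : MI.mem S (eK / digammaNode K) (mulRatBox E (2 / (4 * (K : ℚ) + 1))) := by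
            have := mem_mulRatBox (mem_nodeExp hS hE) (2 / (4 * (K : ℚ) + 1))
            rw [heK, div_eq_mul_inv, inv_digammaNode]; exact this
          have hQ := MI.mem_divPos hS hR hnum hden
          rw [div_eq_mul_inv] at hQ
          exact le_trans (mul_le_mul_of_nonneg_right hle hSr.le) hQ.2
        · simp at hu
      · simp at hu
  · simp at hT

end Tail

/-! ## The Markov (killing) constant -/

section Markov

variable {S : ℕ} {a : ℚ}

/-- Box of `M_a = 2Σ_q Λ(q)q^{−1/2} + (π/2 + log 2) + (log 4π + γ)` from the prime weights and boxes of `π`, `log 2`, `log π`, `γ`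
(`log 4π = 2 log 2 + log π`). -/
def markovBox (S : ℕ) (wts : List MI) (n : ℕ) (P L2 LPi G : MI) : MI :=
  (((sumBox S (fun i ↦ wts.getD i default) n).mulInt 2).add ((P.divNat 2).add L2)).add
    (((L2.mulInt 2).add LPi).add G)

/-- **`markovBox ∋ weilMarkovConstant a`**. -/
theorem mem_markovBox {ks : List PrimeLen} (hks : PrimeData (a : ℝ) ks) {C : Consts}
    (hC : ConstsValid S (a : ℝ) ks C) {P L2 LPi G : MI} (hP : MI.mem S Real.pi P) (hL2 : MI.mem S (Real.log 2) L2)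
    (hLPi : MI.mem S (Real.log Real.pi) LPi) (hG : MI.mem S Real.eulerMascheroniConstant G) :
    MI.mem S (weilMarkovConstant (a : ℝ)) (markovBox S C.wts ks.length P L2 LPi G) := by
  have hsum : ∑ n ∈ weilPrimeIndex (a : ℝ), (Λ n : ℝ) / Real.sqrt n =
      ∑ i ∈ Finset.range ks.length, (ks.getD i default).wt := by
    have h := sum_weilPrimeIndex_mul_eq_listSum hks (fun _ ↦ (1 : ℝ))
    simp only [mul_one] at h
    rw [h, list_sum_map_eq_sum_range]
  have hlog4pi : Real.log (4 * Real.pi) = Real.log 2 * (2 : ℤ) + Real.log Real.pi := by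
    rw [Real.log_mul (by norm_num) Real.pi_pos.ne', show (4 : ℝ) = 2 ^ 2 by norm_num, Real.log_pow]
    push_cast; ring
  rw [weilMarkovConstant_eq, hsum, markovBox, hlog4pi]
  have h1 := MI.mem_mulInt (mem_sumBox (S := S) (f := fun i ↦ C.wts.getD i default)
    (g := fun i ↦ (ks.getD i default).wt) ks.length fun i hi ↦ hC.wts i hi) 2
  have h2 := MI.mem_add (MI.mem_divNat hP (n := 2) (by norm_num)) hL2
  have h3 := MI.mem_add (MI.mem_add (MI.mem_mulInt hL2 2) hLPi) hG
  have h := MI.mem_add (MI.mem_add h1 h2) h3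
  convert h using 1
  push_cast
  ring

end Markov

/-! ## The entry -/

section Entry

variable {S Kser kred : ℕ} {a : ℚ}

/-- The real value `E_{jk}` of the entry `W_a(1x^j, 1x^k)`, verbatim the cast real number of `weilWindowSesq_indicator_pow`. -/
noncomputable def entryVal (a : ℝ) (j k : ℕ) : ℝ :=
  (2 * (∫ x in (-a)..a, x ^ j * Real.cosh (x / 2)) * (∫ x in (-a)..a, x ^ k * Real.cosh (x / 2)) -
      2 * (∫ x in (-a)..a, x ^ j * Real.sinh (x / 2)) * (∫ x in (-a)..a, x ^ k * Real.sinh (x / 2)))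
    + ((∑ n ∈ weilPrimeIndex a, (Λ n : ℝ) / Real.sqrt n *
        (2 * ((a ^ (j + k + 1) - (-a) ^ (j + k + 1)) / (j + k + 1))
          - (∑ i ∈ Finset.range (j + 1), (j.choose i : ℝ) * Real.log n ^ (j - i) *
              (((a - Real.log n) ^ (i + k + 1) - (-a) ^ (i + k + 1)) / (i + k + 1)))
          - (∑ i ∈ Finset.range (k + 1), (k.choose i : ℝ) * Real.log n ^ (k - i) *
              (((a - Real.log n) ^ (i + j + 1) - (-a) ^ (i + j + 1)) / (i + j + 1)))))
      + ((∫ t in Ioc 0 (2 * a), weilArchDensity t *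
          (2 * ((a ^ (j + k + 1) - (-a) ^ (j + k + 1)) / (j + k + 1))
            - (∑ i ∈ Finset.range (j + 1), (j.choose i : ℝ) * t ^ (j - i) *
                (((a - t) ^ (i + k + 1) - (-a) ^ (i + k + 1)) / (i + k + 1)))
            - (∑ i ∈ Finset.range (k + 1), (k.choose i : ℝ) * t ^ (k - i) *
                (((a - t) ^ (i + j + 1) - (-a) ^ (i + j + 1)) / (i + j + 1)))))
        + 2 * ((a ^ (j + k + 1) - (-a) ^ (j + k + 1)) / (j + k + 1)) * ∫ t in Ioi (2 * a), weilArchDensity t))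
    - weilMarkovConstant a * ((a ^ (j + k + 1) - (-a) ^ (j + k + 1)) / (j + k + 1))

/-- `weilWindowSesq a (1x^j) (1x^k) = E_{jk}` (restatement of `weilWindowSesq_indicator_pow`; `a > 0`). -/
theorem weilWindowSesq_indicator_pow_eq_entryVal {a : ℝ} (ha : 0 < a) (j k : ℕ) :
    weilWindowSesq a ((Icc (-a) a).indicator fun x : ℝ ↦ ((x : ℂ)) ^ j)
        ((Icc (-a) a).indicator fun x : ℝ ↦ ((x : ℂ)) ^ k) = ((entryVal a j k : ℝ) : ℂ) :=
  weilWindowSesq_indicator_pow ha j k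

/-- **The entry box** `POLE + PRIME + (ARCH_in + 2m·TAIL) − M_a·m`. -/
def entryBox (S : ℕ) (Ep Em : MI) (C : Consts) (nks : ℕ) (tab : List MI) (T Mk : MI) (a : ℚ) (j k : ℕ) : MI :=
  (((poleBox S Ep Em a j k).add (primeBox S a C.lens C.wts j k nks)).add
      ((archInBox S tab a j k).add (mulRatBox T (2 * momentQ a (j + k))))).sub
    (mulRatBox Mk (momentQ a (j + k)))

/-- **Soundness of the entry box.**  For a rational window `a > 0`, its prime data `ks` with validated constants `C`
(lengths and weights at scale `S`), boxes `E^{±} ∋ e^{±a/2}`, a valid table `tab` of window constants up to `Q ≥ j+k+1`,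
`T ∋ ∫_{(2a,∞)} ρ` and `Mk ∋ M_a`:  `E_{jk} = W_a(1x^j, 1x^k) ∈ entryBox …`. -/
theorem mem_entryBox (hS : 0 < S) (ha : 0 < a) {ks : List PrimeLen} (hks : PrimeData (a : ℝ) ks) {C : Consts}
    (hC : ConstsValid S (a : ℝ) ks C) {Ep Em : MI} (hEp : MI.mem S (Real.exp ((a : ℝ) / 2)) Ep)
    (hEm : MI.mem S (Real.exp (-((a : ℝ) / 2))) Em) {tab : List MI} {Q : ℕ}
    (hW : ∀ q, 1 ≤ q → q ≤ Q → MI.mem S (∫ t in Ioc 0 (2 * (a : ℝ)), weilArchDensity t * t ^ q) (wtab tab q))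
    {T : MI} (hT : MI.mem S (∫ t in Ioi (2 * (a : ℝ)), weilArchDensity t) T)
    {Mk : MI} (hMk : MI.mem S (weilMarkovConstant (a : ℝ)) Mk) {j k : ℕ} (hjk : j + k + 1 ≤ Q) :
    MI.mem S (entryVal (a : ℝ) j k) (entryBox S Ep Em C ks.length tab T Mk a j k) := by
  have hpole := mem_poleBox hS hEp hEm j k
  have hprime := mem_primeBox hS hks hC j k
  have harch := mem_archInBox (S := S) ha hW hjk
  have hm : ∀ c : ℚ, MI.mem S ((∫ t in Ioi (2 * (a : ℝ)), weilArchDensity t) * (c : ℝ)) (mulRatBox T c) :=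
    fun c ↦ mem_mulRatBox hT c
  have htail := hm (2 * momentQ a (j + k))
  have hmk := mem_mulRatBox hMk (momentQ a (j + k))
  have h := MI.mem_sub (MI.mem_add (MI.mem_add hpole hprime) (MI.mem_add harch htail)) hmk
  rw [entryBox]
  convert h using 1
  rw [entryVal]
  push_cast
  rw [momentQ_cast]
  push_cast
  ring

end Entry

end WinEntry

end Summit.RiemannHypothesis.RiemannHypothesis.Theorems.WeilFormatC
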